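import Summits.HodgeConjecture.HodgeConjecture.Theorems.F0P3cStCharTSOffStratumG        -- ★ p849350-era (LH6-p04 (g2)): `valuation_eq_one_of_map_mul_self`, `map_mul_self_eq_one_of_scalar_mem`; brings the CM carriers
import Literature.NumberTheory.Automorphic.LocalUnitaryGroupCenter                       -- ★ `localNonsplitEquiv_mem_center`, `exists_coe_eq_scalar_of_mem_center_unitaryGroupOfForm`
import Literature.NumberTheory.Automorphic.UnitaryGroupInertPlaceHyperbolicBasis         -- ★ `galAdicCompletionMap_galAdicCompletionMap_of_smul_eq`, `placeForm_hermitian_of_smul_eq`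
import Literature.NumberTheory.Automorphic.UnitaryGroupBorelInduction                    -- ★ `cmLocalForm` (XIG's carrier `↥(unitaryGroupOfForm (c ⊗ 1) (cmLocalForm L 3 v))`)
import Literature.NumberTheory.Automorphic.FiniteAdeleFactorizable                       -- ★ `isClopen_setOf_valued_le` (closed valuation balls of `L_w` are clopen)
import Literature.NumberTheory.Rogawski1990.CMLocalAPacketMembers                        -- ★ `qsForm` (the abbrev in the `hK`∕`hz` texts of ★ p849833)
import Mathlib.GroupTheory.DoubleCoset
import HarnessLib

/-!
# F0 · P3c · line LH6 «StCharTS» — road (D) «DEEP-FL», brick «G-SHELL-DATA★»: the `G`-side hypotheses `hK`, `hz`∕`hβ`, `hf` of ★ p849833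
# `isLocalDeltaTransfer_of_levi'` DISCHARGED from the «XIG-St» binders (central `z`, Iwahori levels `𝓘.K n`, the shell indicator `𝟙_{K_n (z aᵐ) K_n}`)

Cell `pub/hodgecm-mathlib`, crux H413 = `stmt-HodgeConjecture-24833` (lane `--supports … --as helper`), route HCCMUnconditional; seat LH4-p02 (g3) on the deal of the
road (D) owner LH6-p04 (g3) (2026-09-02T06:30:04Z «G-SHELL-DATA★»).  THEOREMS ONLY, sorry-free, ★-only imports; no definition ∕ instance ∕ notation ∕ named fact.
HONEST LABEL: HC_CM is proved only modulo the 7 printed citations (2 remaining: hLiu418 = stmt-HodgeConjecture-24832, h413 = stmt-HodgeConjecture-24833) until rung 0 closes;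
count-neutral plumbing of road (D) (inputs of the (D-c) HEAD «XIG-ASSEMBLY»).

THE MATHEMATICS.  `G = U(Φ₃)(L⁺_v)` at a finite place `v` of `L⁺` that does not split in the CM field `L` (`w ∣ v` the place above, `c • w = w`), read in the
one-place model `E₃ = localNonsplitEquiv : G ≃ₜ* U(σ_w, Φ₃)(L_w)` ([PlatonovRapinchuk1994, §5.1]).
* (G1) «CENTRAL ⇒ SCALAR OF ABSOLUTE VALUE ONE»: a central `z ∈ G` is `β · 1` in the model with `σ_w(β) β = 1`, hence `|β|_w = 1` — the centre of a unitary group of a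
  non-degenerate hermitian form over a field is scalar ([PlatonovRapinchuk1994, §2.3]; ★ `exists_coe_eq_scalar_of_mem_center_unitaryGroupOfForm`), unitarity of a scalar
  reads `σ_w(β) β = 1` (★ `map_mul_self_eq_one_of_scalar_mem`), and `|σ_w β|_w = |β|_w` (★ `valued_galAdicCompletionMap`).  This is the `hz`∕`hβ` pair of ★ p849833
  ([Rogawski1990, §12.7 L. 12.7.3 proof p. 195]: «`z` central»).
* (G2) «LEVEL NEIGHBOURHOOD»: for every radius `r ≠ 0` the set `{g ∈ G | ∀ i j, |E₃(g)_{ij} − δ_{ij}|_w ≤ r}` is a neighbourhood of `1` (continuity of `E₃` and of the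
  matrix entries; closed valuation balls are open) — so the Iwahori levels `K_n ⊆ U` of «XIG-St» satisfy the `hK` clause of ★ p849833 with `r = q_w^{-1} < 1`
  ([Casselman1995, Prop. 1.4.4]: the `K_n` form a neighbourhood basis of `1`).
* (G3) «SHELL SUPPORT»: a double coset `K b K` of an OPEN subgroup `K` of a topological group is clopen, so `tsupport 𝟙_{K b K} ⊆ K b K` — the `hf` clause of ★ p849833
  for the shell indicator of «XIG-St» ([Rogawski1990, §4.9 p. 54]: characteristic functions of double cosets).

* §1 (G1) `map_mul_self_eq_one_of_mem_center`, **`exists_coe_localNonsplitEquiv_eq_smul_one_of_mem_center`**;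
* §2 (G2) `continuous_coe_localNonsplitEquiv_apply_sub_one`, **`setOf_forall_valued_sub_one_le_mem_nhds_one`**, `exp_neg_one_lt_one`, **`exists_nhds_one_forall_valued_sub_one_le`**;
* §3 (G3) `isOpen_doubleCoset'`, **`isClosed_doubleCoset`**, `tsupport_indicator_doubleCoset_subset`, **`tsupport_indicator_one_doubleCoset_subset`**.

## References
* [Rogawski1990] J. D. Rogawski, *Automorphic Representations of Unitary Groups in Three Variables*, Ann. of Math. Stud. 123 (1990): §4.9 p. 54; §12.7 Lemma 12.7.3 (proof) p. 195.
* [PlatonovRapinchuk1994] V. Platonov, A. Rapinchuk, *Algebraic Groups and Number Theory* (1994), §2.3, §5.1.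
* [Casselman1995] W. Casselman, *Introduction to the theory of admissible representations of p-adic reductive groups* (1995), Prop. 1.4.4.
-/

set_option autoImplicit false
-- the mandated namespace has the single-problem summit's repeated segment (`HodgeConjecture.HodgeConjecture`)
set_option linter.dupNamespace false

noncomputable section

open Matrix NumberField IsDedekindDomain Topology Filter
open scoped MatrixGroups Pointwise
open Literature.NumberTheory.Rogawski1990 Literature.NumberTheory.Automorphic Literature.NumberTheory.Automorphic.UnitaryGroup
open Literature.NumberTheory.GaloisRepresentations

namespace Summit.HodgeConjecture.HodgeConjecture.Cruxes.H413.F0P3cStCharTSGShellData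

/-! ## §1 (G1) «CENTRAL ⇒ SCALAR OF ABSOLUTE VALUE ONE» — the `hz`∕`hβ` clauses of ★ `isLocalDeltaTransfer_of_levi'` -/

section Central

variable (L : Type) [Field L] [NumberField L] [IsCMField L] (v : HeightOneSpectrum (𝓞 ↥(maximalRealSubfield L)))
  (w : PlacesOver L v) (hw : IsCMField.complexConj L • w.1 = w.1)

/-- In the one-place model `U(σ_w, Φ₃)(L_w)`: a SCALAR element `β · 1` has `σ_w(β) β = 1` and `|β|_w = 1` (the `(0,2)` entry of the local form `Φ₃` is `1 ≠ 0`;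
★ `map_mul_self_eq_one_of_scalar_mem`, ★ `valuation_eq_one_of_map_mul_self`, ★ `valued_galAdicCompletionMap`). [cite: PlatonovRapinchuk1994, §2.3] -/
theorem valued_eq_one_of_coe_eq_smul_one
    {g : ↥(unitaryGroupOfForm (galAdicCompletionMap (L := L) (IsCMField.complexConj L) hw) (placeForm (qsForm L) w.1))} {β : w.1.adicCompletion L}
    (hg : (((g : ↥(unitaryGroupOfForm (galAdicCompletionMap (L := L) (IsCMField.complexConj L) hw) (placeForm (qsForm L) w.1))) :
        GL (Fin 3) (w.1.adicCompletion L)) : Matrix (Fin 3) (Fin 3) (w.1.adicCompletion L)) = β • (1 : Matrix (Fin 3) (Fin 3) (w.1.adicCompletion L))) :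
    galAdicCompletionMap (L := L) (IsCMField.complexConj L) hw β * β = 1 ∧ Valued.v β = 1 := by
  have h02 : placeForm (qsForm L) w.1 0 2 ≠ 0 := by
    simp only [placeForm, qsForm, Matrix.map_apply, Matrix.of_apply]
    simp
  have hmul : galAdicCompletionMap (L := L) (IsCMField.complexConj L) hw β * β = 1 :=
    F0P3cStCharTSOffStratumG.map_mul_self_eq_one_of_scalar_mem (galAdicCompletionMap (L := L) (IsCMField.complexConj L) hw) h02 g.2 hg
  exact ⟨hmul, F0P3cStCharTSOffStratumG.valuation_eq_one_of_map_mul_self Valued.v (galAdicCompletionMap (L := L) (IsCMField.complexConj L) hw)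
    (fun x => valued_galAdicCompletionMap (L := L) (IsCMField.complexConj L) hw x) hmul⟩

/-- **(G1) «CENTRAL ⇒ SCALAR», the `hz`∕`hβ` clauses of ★ `isLocalDeltaTransfer_of_levi'` (p849833) from the «XIG-St» binder `z ∈ Z(U(Φ₃)(L⁺_v))`.**
For `z` central in `U(Φ₃)(L⁺_v) = ↥(unitaryGroupOfForm (c ⊗ 1) (cmLocalForm L 3 v))` and `w ∣ v` non-split (`c • w = w`): in the one-place model
`E₃ = localNonsplitEquiv c Φ₃ _ w hw`, `E₃ z = β • 1` for some `β ∈ L_w` with `|β|_w = 1` (and `σ_w(β) β = 1`).  The centre of `U(σ_w, Φ₃)(L_w)` is scalar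
(★ `exists_coe_eq_scalar_of_mem_center_unitaryGroupOfForm` over the field `L_w`, `2, 3 ≠ 0` in characteristic `0`; centrality transported by ★ `localNonsplitEquiv_mem_center`).
[cite: PlatonovRapinchuk1994, §2.3; §5.1] [cite: Rogawski1990, §12.7 L. 12.7.3 (proof) p. 195] -/
theorem exists_coe_localNonsplitEquiv_eq_smul_one_of_mem_center
    {z : ↥(unitaryGroupOfForm (conjLocal L (IsCMField.complexConj L) v) (cmLocalForm L 3 v))}
    (hz : z ∈ Subgroup.center ↥(unitaryGroupOfForm (conjLocal L (IsCMField.complexConj L) v) (cmLocalForm L 3 v))) :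
    ∃ β : w.1.adicCompletion L,
      (((localNonsplitEquiv (IsCMField.complexConj L) (qsForm L) (IsCMField.complexConj_ne_one L) w hw z :
          ↥(unitaryGroupOfForm (galAdicCompletionMap (L := L) (IsCMField.complexConj L) hw) (placeForm (qsForm L) w.1))) :
          GL (Fin 3) (w.1.adicCompletion L)) : Matrix (Fin 3) (Fin 3) (w.1.adicCompletion L)) = β • (1 : Matrix (Fin 3) (Fin 3) (w.1.adicCompletion L)) ∧
      Valued.v β = 1 ∧ galAdicCompletionMap (L := L) (IsCMField.complexConj L) hw β * β = 1 := by
  haveI : CharZero (w.1.adicCompletion L) := charZero_of_injective_algebraMap (algebraMap L (w.1.adicCompletion L)).injective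
  have hz' : localNonsplitEquiv (IsCMField.complexConj L) (qsForm L) (IsCMField.complexConj_ne_one L) w hw z ∈
      Subgroup.center ↥(unitaryGroupOfForm (galAdicCompletionMap (L := L) (IsCMField.complexConj L) hw) (placeForm (qsForm L) w.1)) :=
    localNonsplitEquiv_mem_center (IsCMField.complexConj L) (qsForm L) v (IsCMField.complexConj_ne_one L) w hw hz
  obtain ⟨u, hu⟩ := exists_coe_eq_scalar_of_mem_center_unitaryGroupOfForm (galAdicCompletionMap (L := L) (IsCMField.complexConj L) hw)
    (placeForm (qsForm L) w.1) (galAdicCompletionMap_galAdicCompletionMap_of_smul_eq (IsCMField.complexConj L) w (IsCMField.complexConj_ne_one L) hw)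
    (placeForm_hermitian_of_smul_eq (IsCMField.complexConj L) w (qsForm L) (antidiagOne_isHermitian L 3) hw)
    ((Matrix.isUnit_iff_isUnit_det _).1 (isUnit_placeForm_of_isUnit_det (isUnit_antidiagOne_det L 3) w.1)).ne_zero two_ne_zero three_ne_zero hz'
  have hmat : (((localNonsplitEquiv (IsCMField.complexConj L) (qsForm L) (IsCMField.complexConj_ne_one L) w hw z :
          ↥(unitaryGroupOfForm (galAdicCompletionMap (L := L) (IsCMField.complexConj L) hw) (placeForm (qsForm L) w.1))) :
          GL (Fin 3) (w.1.adicCompletion L)) : Matrix (Fin 3) (Fin 3) (w.1.adicCompletion L)) =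
        (u : w.1.adicCompletion L) • (1 : Matrix (Fin 3) (Fin 3) (w.1.adicCompletion L)) := by
    rw [hu, Matrix.GeneralLinearGroup.coe_scalar, Matrix.scalar_apply, Matrix.smul_one_eq_diagonal]
  exact ⟨u, hmat, (valued_eq_one_of_coe_eq_smul_one L v w hw hmat).2, (valued_eq_one_of_coe_eq_smul_one L v w hw hmat).1⟩

end Central

/-! ## §2 (G2) «LEVEL NEIGHBOURHOOD» — the `hK` clause of ★ `isLocalDeltaTransfer_of_levi'` for every small enough level -/

section Level

/-- `q_w^{-1} < 1` in `ℤᵐ⁰` (the radius at which (G2) feeds the `hr : r < 1` binder of ★ `isLocalDeltaTransfer_of_levi'`). [folklore] -/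
theorem exp_neg_one_lt_one : WithZero.exp (-1 : ℤ) < (1 : WithZero (Multiplicative ℤ)) := by
  rw [← WithZero.exp_zero]
  exact WithZero.exp_lt_exp.2 (by norm_num)

variable (L : Type) [Field L] [NumberField L] [IsCMField L] (v : HeightOneSpectrum (𝓞 ↥(maximalRealSubfield L)))
  (w : PlacesOver L v) (hw : IsCMField.complexConj L • w.1 = w.1)

/-- The entry maps `g ↦ E₃(g)_{ij} − δ_{ij}` of the one-place model are continuous on `U(Φ₃)(L⁺_v)` (`E₃` is an isomorphism of TOPOLOGICAL groups).
[cite: PlatonovRapinchuk1994, §5.1] -/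
theorem continuous_coe_localNonsplitEquiv_apply_sub_one (i j : Fin 3) :
    Continuous fun g : ↥(unitaryGroupOfForm (conjLocal L (IsCMField.complexConj L) v) (cmLocalForm L 3 v)) =>
      (((localNonsplitEquiv (IsCMField.complexConj L) (qsForm L) (IsCMField.complexConj_ne_one L) w hw g :
          ↥(unitaryGroupOfForm (galAdicCompletionMap (L := L) (IsCMField.complexConj L) hw) (placeForm (qsForm L) w.1))) :
          GL (Fin 3) (w.1.adicCompletion L)) : Matrix (Fin 3) (Fin 3) (w.1.adicCompletion L)) i j - (1 : Matrix (Fin 3) (Fin 3) (w.1.adicCompletion L)) i j := by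
  have hE : Continuous fun g : ↥(unitaryGroupOfForm (conjLocal L (IsCMField.complexConj L) v) (cmLocalForm L 3 v)) =>
      (((localNonsplitEquiv (IsCMField.complexConj L) (qsForm L) (IsCMField.complexConj_ne_one L) w hw g :
          ↥(unitaryGroupOfForm (galAdicCompletionMap (L := L) (IsCMField.complexConj L) hw) (placeForm (qsForm L) w.1))) :
          GL (Fin 3) (w.1.adicCompletion L)) : Matrix (Fin 3) (Fin 3) (w.1.adicCompletion L)) :=
    Units.continuous_val.comp (continuous_subtype_val.comp
      (localNonsplitEquiv (IsCMField.complexConj L) (qsForm L) (IsCMField.complexConj_ne_one L) w hw).continuous)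
  exact (hE.matrix_elem i j).sub continuous_const

/-- **(G2) «LEVEL NEIGHBOURHOOD».**  For every radius `r ≠ 0` of `ℤᵐ⁰`, the set of `g ∈ U(Φ₃)(L⁺_v)` whose one-place model `E₃ g` is entrywise within `r` of `1`
(`∀ i j, |E₃(g)_{ij} − δ_{ij}|_w ≤ r`) is a NEIGHBOURHOOD of `1` — preimage of the open closed-balls (★ `isClopen_setOf_valued_le`) under the continuous entry maps,
containing `1` since `E₃ 1 = 1`.  With `r < 1` this is the `hK` clause of ★ `isLocalDeltaTransfer_of_levi'` for every subgroup `K_n ⊆` this set.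
[cite: Casselman1995, Prop. 1.4.4] [cite: PlatonovRapinchuk1994, §5.1] -/
theorem setOf_forall_valued_sub_one_le_mem_nhds_one {r : WithZero (Multiplicative ℤ)} (hr : r ≠ 0) :
    {g : ↥(unitaryGroupOfForm (conjLocal L (IsCMField.complexConj L) v) (cmLocalForm L 3 v)) |
      ∀ i j, Valued.v ((((localNonsplitEquiv (IsCMField.complexConj L) (qsForm L) (IsCMField.complexConj_ne_one L) w hw g :
          ↥(unitaryGroupOfForm (galAdicCompletionMap (L := L) (IsCMField.complexConj L) hw) (placeForm (qsForm L) w.1))) :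
          GL (Fin 3) (w.1.adicCompletion L)) : Matrix (Fin 3) (Fin 3) (w.1.adicCompletion L)) i j - (1 : Matrix (Fin 3) (Fin 3) (w.1.adicCompletion L)) i j) ≤ r}
      ∈ 𝓝 (1 : ↥(unitaryGroupOfForm (conjLocal L (IsCMField.complexConj L) v) (cmLocalForm L 3 v))) := by
  have hset : {g : ↥(unitaryGroupOfForm (conjLocal L (IsCMField.complexConj L) v) (cmLocalForm L 3 v)) |
      ∀ i j, Valued.v ((((localNonsplitEquiv (IsCMField.complexConj L) (qsForm L) (IsCMField.complexConj_ne_one L) w hw g :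
          ↥(unitaryGroupOfForm (galAdicCompletionMap (L := L) (IsCMField.complexConj L) hw) (placeForm (qsForm L) w.1))) :
          GL (Fin 3) (w.1.adicCompletion L)) : Matrix (Fin 3) (Fin 3) (w.1.adicCompletion L)) i j - (1 : Matrix (Fin 3) (Fin 3) (w.1.adicCompletion L)) i j) ≤ r}
      = ⋂ i : Fin 3, ⋂ j : Fin 3, (fun g : ↥(unitaryGroupOfForm (conjLocal L (IsCMField.complexConj L) v) (cmLocalForm L 3 v)) =>
          (((localNonsplitEquiv (IsCMField.complexConj L) (qsForm L) (IsCMField.complexConj_ne_one L) w hw g :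
            ↥(unitaryGroupOfForm (galAdicCompletionMap (L := L) (IsCMField.complexConj L) hw) (placeForm (qsForm L) w.1))) :
            GL (Fin 3) (w.1.adicCompletion L)) : Matrix (Fin 3) (Fin 3) (w.1.adicCompletion L)) i j - (1 : Matrix (Fin 3) (Fin 3) (w.1.adicCompletion L)) i j) ⁻¹'
          {y : w.1.adicCompletion L | Valued.v y ≤ r} := by
    ext g
    simp only [Set.mem_setOf_eq, Set.mem_iInter, Set.mem_preimage]
  rw [hset]
  refine Filter.iInter_mem.2 fun i => Filter.iInter_mem.2 fun j => ?_
  refine ((isClopen_setOf_valued_le L w.1 hr).isOpen.preimage (continuous_coe_localNonsplitEquiv_apply_sub_one L v w hw i j)).mem_nhds ?_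
  have h1 : localNonsplitEquiv (IsCMField.complexConj L) (qsForm L) (IsCMField.complexConj_ne_one L) w hw
      (1 : ↥(unitaryGroupOfForm (conjLocal L (IsCMField.complexConj L) v) (cmLocalForm L 3 v))) = 1 := map_one _
  rw [Set.mem_preimage, Set.mem_setOf_eq, h1, OneMemClass.coe_one, Units.val_one, sub_self, map_zero]
  exact zero_le

/-- **(G2) in the CONSUMER'S SHAPE**: a radius `r < 1` and a neighbourhood `U ∈ 𝓝 1` of `U(Φ₃)(L⁺_v)` such that EVERY subgroup `K_n ⊆ U` satisfies the `hK` clause of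
★ `isLocalDeltaTransfer_of_levi'` (p849833) token for token (`∀ k ∈ K_n, ∀ i j, |E₃(k)_{ij} − δ_{ij}|_w ≤ r`) — the «XIG-St» head picks its `U` inside this one and feeds
the Iwahori levels `𝓘.K n ⊆ U`. [cite: Casselman1995, Prop. 1.4.4] [cite: Rogawski1990, §12.7 L. 12.7.3 (proof) p. 195] -/
theorem exists_nhds_one_forall_valued_sub_one_le :
    ∃ r : WithZero (Multiplicative ℤ), r < 1 ∧
      ∃ U ∈ 𝓝 (1 : ↥(unitaryGroupOfForm (conjLocal L (IsCMField.complexConj L) v) (cmLocalForm L 3 v))),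
        ∀ Kn : Subgroup ↥(unitaryGroupOfForm (conjLocal L (IsCMField.complexConj L) v) (cmLocalForm L 3 v)),
          (Kn : Set ↥(unitaryGroupOfForm (conjLocal L (IsCMField.complexConj L) v) (cmLocalForm L 3 v))) ⊆ U →
          ∀ k ∈ Kn, ∀ i j, Valued.v ((((localNonsplitEquiv (IsCMField.complexConj L) (qsForm L) (IsCMField.complexConj_ne_one L) w hw k :
            ↥(unitaryGroupOfForm (galAdicCompletionMap (L := L) (IsCMField.complexConj L) hw) (placeForm (qsForm L) w.1))) :
            GL (Fin 3) (w.1.adicCompletion L)) : Matrix (Fin 3) (Fin 3) (w.1.adicCompletion L)) i j - (1 : Matrix (Fin 3) (Fin 3) (w.1.adicCompletion L)) i j) ≤ r :=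
  ⟨WithZero.exp (-1 : ℤ), exp_neg_one_lt_one, _, setOf_forall_valued_sub_one_le_mem_nhds_one L v w hw WithZero.exp_ne_zero,
    fun _ hKU _ hk i j => hKU hk i j⟩

end Level

/-! ## §3 (G3) «SHELL SUPPORT» — double cosets of an open subgroup are clopen; the `hf` clause of ★ `isLocalDeltaTransfer_of_levi'` for `𝟙_{K b K}` -/

section Shell

variable {G : Type*} [Group G] [TopologicalSpace G] [IsTopologicalGroup G]

/-- A double coset `H b K` with `H` an OPEN subgroup is open (`H · {b} · K` is a union of translates of `H`). [cite: Rogawski1990, §4.9 p. 54] -/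
theorem isOpen_doubleCoset' (H K : Subgroup G) (hH : IsOpen (H : Set G)) (b : G) : IsOpen (DoubleCoset.doubleCoset b (H : Set G) (K : Set G)) := by
  unfold DoubleCoset.doubleCoset
  exact (hH.mul_right).mul_right

/-- **A double coset `H b K` with `H` an OPEN subgroup is CLOSED**: its complement is the union of the other `(H, K)`-double cosets, each open and disjoint from it
(★ Mathlib `DoubleCoset.eq_of_not_disjoint`). [cite: Rogawski1990, §4.9 p. 54] -/
theorem isClosed_doubleCoset (H K : Subgroup G) (hH : IsOpen (H : Set G)) (b : G) : IsClosed (DoubleCoset.doubleCoset b (H : Set G) (K : Set G)) := by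
  rw [← isOpen_compl_iff, isOpen_iff_forall_mem_open]
  intro y hy
  refine ⟨DoubleCoset.doubleCoset y (H : Set G) (K : Set G), fun x hx hxD => hy ?_, isOpen_doubleCoset' H K hH y, DoubleCoset.mem_doubleCoset_self H K y⟩
  have hD : DoubleCoset.doubleCoset y (H : Set G) (K : Set G) = DoubleCoset.doubleCoset b (H : Set G) (K : Set G) :=
    DoubleCoset.eq_of_not_disjoint (Set.not_disjoint_iff.2 ⟨x, hx, hxD⟩)
  rw [← hD]
  exact DoubleCoset.mem_doubleCoset_self H K y

/-- The topological support of ANY function cut off to a double coset `H b K` (`H` open) lies in `H b K` (`tsupport = closure support ⊆ closure (H b K) = H b K`).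
[cite: Rogawski1990, §4.9 p. 54] -/
theorem tsupport_indicator_doubleCoset_subset {M : Type*} [Zero M] (H K : Subgroup G) (hH : IsOpen (H : Set G)) (b : G) (f : G → M) :
    tsupport ((DoubleCoset.doubleCoset b (H : Set G) (K : Set G)).indicator f) ⊆ DoubleCoset.doubleCoset b (H : Set G) (K : Set G) :=
  closure_minimal Set.support_indicator_subset (isClosed_doubleCoset H K hH b)

/-- **(G3) «SHELL SUPPORT», the `hf` clause of ★ `isLocalDeltaTransfer_of_levi'` (p849833) for the shell indicator of «XIG-St»**: for a subgroup `K` open in a topological group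
(e.g. an Iwahori level `𝓘.K n`, ★ `IwahoriDatum.isOpen_K`) and any `b` (e.g. `z · 𝓘.a ^ m`), `tsupport 𝟙_{K b K} ⊆ K b K`. [cite: Rogawski1990, §4.9 p. 54; §12.7 L. 12.7.3 (proof) p. 195] -/
theorem tsupport_indicator_one_doubleCoset_subset (K : Subgroup G) (hK : IsOpen (K : Set G)) (b : G) :
    tsupport ((DoubleCoset.doubleCoset b (K : Set G) (K : Set G)).indicator fun _ => (1 : ℂ)) ⊆ DoubleCoset.doubleCoset b (K : Set G) (K : Set G) :=
  tsupport_indicator_doubleCoset_subset K K hK b fun _ => (1 : ℂ)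

end Shell

end Summit.HodgeConjecture.HodgeConjecture.Cruxes.H413.F0P3cStCharTSGShellData

end
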